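import Summits.QuantumFields.BalabanUV.Beta.D1BFx.GhostReleggingShell

/-!
# `BalabanUV.Beta.D1BFx.GhostReleggingShellAvg` — road «BF-x» for binder row D1, sub-leaf A2′-SHELL (part 2): THE RE-LEGGING BOUND IN
# SHELL CURRENCY, BASE-POINT AVERAGED AT ALL SCALES — the shape of `ShellRoadEnd.d1Drift_of_strongRoad_shell`'s rows

HONEST DEPENDENCY (page 1, mandatory): continuum YM on T⁴ ⇐ BetaPertH ∧ nine spine estimates (0/9 proved); BetaPertH ⇐ (D1) ∧
(D4) ∧ CAP+tail; G-an2-4 gates asym, D1 and NE2/3/4.  HONEST FRAMING (cell contract, verbatim): «discharging `BetaPertH` makes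
Bałaban's UV stability UNCONDITIONAL — a real constructive-QFT result; it is NOT the continuum limit and NOT the Clay problem.»
THIS MODULE DISCHARGES NOTHING of the wall: [folklore] convex-combination bookkeeping over part 1's `abs_fullSum_stKI_sub_le_shell` (the
argument of leaf-10's `GhostRelegging.abs_avg_fullSum_stKI_sub_le` verbatim).  Every row is a HYPOTHESIS on two FREE leg families; no
analytic row for any actual leg is proved; no `def`, no `Prop` mirror, no cited fact, 0 sorry; 0 wall binders; NOT D1, NOT `BetaPertH`,
NOT continuum, NOT Clay.

ABSOLUTE RULE (cell charter, verbatim): «No internally-minted statement may enter as a cited fact. Every hypothesis is either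
kernel-proved in this package or a verbatim quotation of a PUBLISHED theorem with page reference. The manuscript(s) under audit are NOT
citable for their own disputed steps — they are the thing under adjudication; programme-internal (2001/route/tribunal) claims are never
citable.»

CONTENT.  **`abs_avg_fullSum_stKI_sub_le_shell`** (explicit constant) and **`exists_avg_relegging_bound_shell`** (`∃ U ≥ 0`): two leg families
`G₁ n b`, `G₂ n b` BOTH obeying, at every scale `n ≥ 2` and base point `b`, the rows of `ShellRoadEnd.d1Drift_of_strongRoad_shell` (pointwise
`h0/h1/d0/d1`, shell `h2s` on `r + 1 ≤ n` / `d2s` on `r ≥ n`), convex base-point weights ⟹ the averaged `I`-sector full sums differ by at most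
`2·Dsh + 2·80·Et·(1 + 1/δ)` for every `n ≥ 2`.  Unit `b2b-balaban-beta-d1-formalise-leaf-04` (gen 2); `LEAVES-BFx.md` sub-row A2′-SHELL.
-/

namespace Summit.QuantumFields.BalabanUV.Beta.D1BFx.GhostReleggingShellAvg

open Finset
open scoped BigOperators
open Literature.Probability.LatticeModels (annulus)
open Literature.MathematicalPhysics.QuantumFieldTheory.Balaban1983to89
open Literature.MathematicalPhysics.QuantumFieldTheory.Balaban1983to89.Beta
open DyadicShell (Pt supNorm)
open BubbleTransfer (unitVec)
open GhostTable (gFree)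
open SquareTable (BfIdx bfCoeff bfP bfQ)
open WindowIdentification (fullSum)
open Summit.QuantumFields.BalabanUV.Beta.D1BFx.GhostRelegging (stKI tailConst_nonneg)
open Summit.QuantumFields.BalabanUV.Beta.D1BFx.GhostReleggingShell (abs_fullSum_stKI_sub_le_shell shellWinConst_nonneg)

noncomputable section

variable {μ ν : Fin 4}

/-! ## §3 All scales, base-point averaged: the shape of `ShellRoadEnd.d1Drift_of_strongRoad_shell`'s rows -/

section Averaged

variable {κB : Type*}

/-- [folklore] **A2′-SHELL, BASE-POINT-AVERAGED, ALL SCALES.**  Two leg families `G₁ n b`, `G₂ n b` (e.g. the ghost leg and the gluon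
diagonal), BOTH obeying the rows of `ShellRoadEnd.d1Drift_of_strongRoad_shell` (pointwise `h0/h1/d0/d1`, shell `h2s/d2s`; constants free
of the base point), and convex base-point weights: for every `n ≥ 2` the averaged `I`-sector full sums differ by at most
`2·Dsh + 2·80·Et·(1 + 1/δ)`, uniformly in the block size. -/
theorem abs_avg_fullSum_stKI_sub_le_shell (hμν : μ ≠ ν) (N : ℝ) (I : Finset BfIdx) {Bset : ℕ → Finset κB} {wt : ℕ → κB → ℝ}
    {G₁ G₂ : ℕ → κB → Pt → ℝ} {D A : ℕ → ℝ} (hD : ∀ j, 0 ≤ D j) (hA : ∀ j, 0 ≤ A j) {δ : ℝ} (hδ : 0 < δ)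
    (hwt0 : ∀ n : ℕ, 2 ≤ n → ∀ b ∈ Bset n, 0 ≤ wt n b) (hwt1 : ∀ n : ℕ, 2 ≤ n → ∑ b ∈ Bset n, wt n b = 1)
    (h0₁ : ∀ n : ℕ, 2 ≤ n → ∀ b ∈ Bset n, ∀ v, |G₁ n b v - gFree v| ≤ D 0 / (n : ℝ) ^ 2)
    (h1₁ : ∀ n : ℕ, 2 ≤ n → ∀ b ∈ Bset n, ∀ v (ρ : Fin 4),
      |(G₁ n b (v + unitVec ρ) - gFree (v + unitVec ρ)) - (G₁ n b v - gFree v)| ≤ D 1 / (n : ℝ) ^ 3)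
    (h2s₁ : ∀ n : ℕ, 2 ≤ n → ∀ b ∈ Bset n, ∀ r : ℕ, r + 1 ≤ n →
      ∑ v ∈ annulus 4 r (r + 1), |(G₁ n b (v + unitVec ν + unitVec μ) - gFree (v + unitVec ν + unitVec μ)) -
          (G₁ n b (v + unitVec ν) - gFree (v + unitVec ν)) - (G₁ n b (v + unitVec μ) - gFree (v + unitVec μ)) +
          (G₁ n b v - gFree v)| ≤ D 2 / (n : ℝ))
    (d0₁ : ∀ n : ℕ, 2 ≤ n → ∀ b ∈ Bset n, ∀ v : Pt, v ≠ 0 → |G₁ n b v| ≤ A 0 * Real.exp (-(δ / n) * supNorm v) / (supNorm v : ℝ) ^ 2)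
    (d1₁ : ∀ n : ℕ, 2 ≤ n → ∀ b ∈ Bset n, ∀ v : Pt, v ≠ 0 → ∀ ρ : Fin 4,
      |G₁ n b (v + unitVec ρ) - G₁ n b v| ≤ A 1 * Real.exp (-(δ / n) * supNorm v) / (supNorm v : ℝ) ^ 3)
    (d2s₁ : ∀ n : ℕ, 2 ≤ n → ∀ b ∈ Bset n, ∀ r : ℕ, n ≤ r →
      ∑ v ∈ annulus 4 r (r + 1), |G₁ n b (v + unitVec ν + unitVec μ) - G₁ n b (v + unitVec ν) - G₁ n b (v + unitVec μ) + G₁ n b v| ≤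
        A 2 * Real.exp (-(δ / n) * ((r : ℝ) + 1)) / ((r : ℝ) + 1))
    (h0₂ : ∀ n : ℕ, 2 ≤ n → ∀ b ∈ Bset n, ∀ v, |G₂ n b v - gFree v| ≤ D 0 / (n : ℝ) ^ 2)
    (h1₂ : ∀ n : ℕ, 2 ≤ n → ∀ b ∈ Bset n, ∀ v (ρ : Fin 4),
      |(G₂ n b (v + unitVec ρ) - gFree (v + unitVec ρ)) - (G₂ n b v - gFree v)| ≤ D 1 / (n : ℝ) ^ 3)
    (h2s₂ : ∀ n : ℕ, 2 ≤ n → ∀ b ∈ Bset n, ∀ r : ℕ, r + 1 ≤ n →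
      ∑ v ∈ annulus 4 r (r + 1), |(G₂ n b (v + unitVec ν + unitVec μ) - gFree (v + unitVec ν + unitVec μ)) -
          (G₂ n b (v + unitVec ν) - gFree (v + unitVec ν)) - (G₂ n b (v + unitVec μ) - gFree (v + unitVec μ)) +
          (G₂ n b v - gFree v)| ≤ D 2 / (n : ℝ))
    (d0₂ : ∀ n : ℕ, 2 ≤ n → ∀ b ∈ Bset n, ∀ v : Pt, v ≠ 0 → |G₂ n b v| ≤ A 0 * Real.exp (-(δ / n) * supNorm v) / (supNorm v : ℝ) ^ 2)
    (d1₂ : ∀ n : ℕ, 2 ≤ n → ∀ b ∈ Bset n, ∀ v : Pt, v ≠ 0 → ∀ ρ : Fin 4,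
      |G₂ n b (v + unitVec ρ) - G₂ n b v| ≤ A 1 * Real.exp (-(δ / n) * supNorm v) / (supNorm v : ℝ) ^ 3)
    (d2s₂ : ∀ n : ℕ, 2 ≤ n → ∀ b ∈ Bset n, ∀ r : ℕ, n ≤ r →
      ∑ v ∈ annulus 4 r (r + 1), |G₂ n b (v + unitVec ν + unitVec μ) - G₂ n b (v + unitVec ν) - G₂ n b (v + unitVec μ) + G₂ n b v| ≤
        A 2 * Real.exp (-(δ / n) * ((r : ℝ) + 1)) / ((r : ℝ) + 1)) :
    ∀ n : ℕ, 2 ≤ n →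
      |∑ b ∈ Bset n, wt n b * fullSum (stKI μ ν N I (G₁ n b)) - ∑ b ∈ Bset n, wt n b * fullSum (stKI μ ν N I (G₂ n b))| ≤
        2 * (∑ i ∈ I, |bfCoeff N i| *
          (80 * (((bfP hμν i).A + (bfP hμν i).B) * (80 * D ((bfQ hμν i).a - 2)) +
              80 * D ((bfP hμν i).a - 2) * ((bfQ hμν i).A + (bfQ hμν i).B)) +
            80 * D ((bfP hμν i).a - 2) * (80 * D ((bfQ hμν i).a - 2)))) +
        2 * (80 * (∑ i ∈ I, |bfCoeff N i| * (A ((bfP hμν i).a - 2) * (A ((bfQ hμν i).a - 2) * 2 ^ (bfQ hμν i).a))) * (1 + 1 / δ)) := by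
  intro n hn
  set U : ℝ := 2 * (∑ i ∈ I, |bfCoeff N i| *
      (80 * (((bfP hμν i).A + (bfP hμν i).B) * (80 * D ((bfQ hμν i).a - 2)) +
          80 * D ((bfP hμν i).a - 2) * ((bfQ hμν i).A + (bfQ hμν i).B)) +
        80 * D ((bfP hμν i).a - 2) * (80 * D ((bfQ hμν i).a - 2)))) +
    2 * (80 * (∑ i ∈ I, |bfCoeff N i| * (A ((bfP hμν i).a - 2) * (A ((bfQ hμν i).a - 2) * 2 ^ (bfQ hμν i).a))) * (1 + 1 / δ))
    with hU
  have hb : ∀ b ∈ Bset n, |fullSum (stKI μ ν N I (G₁ n b)) - fullSum (stKI μ ν N I (G₂ n b))| ≤ U := fun b hb =>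
    abs_fullSum_stKI_sub_le_shell hμν N I hn hD hA hδ (h0₁ n hn b hb) (h1₁ n hn b hb) (h2s₁ n hn b hb) (d0₁ n hn b hb)
      (d1₁ n hn b hb) (d2s₁ n hn b hb) (h0₂ n hn b hb) (h1₂ n hn b hb) (h2s₂ n hn b hb) (d0₂ n hn b hb) (d1₂ n hn b hb) (d2s₂ n hn b hb)
  rw [← Finset.sum_sub_distrib]
  calc |∑ b ∈ Bset n, (wt n b * fullSum (stKI μ ν N I (G₁ n b)) - wt n b * fullSum (stKI μ ν N I (G₂ n b)))|
      = |∑ b ∈ Bset n, wt n b * (fullSum (stKI μ ν N I (G₁ n b)) - fullSum (stKI μ ν N I (G₂ n b)))| := by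
        congr 1; refine Finset.sum_congr rfl fun b _ => ?_; ring
    _ ≤ ∑ b ∈ Bset n, |wt n b * (fullSum (stKI μ ν N I (G₁ n b)) - fullSum (stKI μ ν N I (G₂ n b)))| :=
        Finset.abs_sum_le_sum_abs _ _
    _ ≤ ∑ b ∈ Bset n, wt n b * U := by
        refine Finset.sum_le_sum fun b hb' => ?_
        rw [abs_mul, abs_of_nonneg (hwt0 n hn b hb')]
        exact mul_le_mul_of_nonneg_left (hb b hb') (hwt0 n hn b hb')
    _ = U := by rw [← Finset.sum_mul, hwt1 n hn, one_mul]

/-- [folklore] **A2′-SHELL IN `∃ U` FORM** (the constant hidden): under the hypotheses of `abs_avg_fullSum_stKI_sub_le_shell` there is ONE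
`U ≥ 0`, free of the block size and of the base point, bounding the averaged re-legging defect at every scale `n ≥ 2`. -/
theorem exists_avg_relegging_bound_shell (hμν : μ ≠ ν) (N : ℝ) (I : Finset BfIdx) {Bset : ℕ → Finset κB} {wt : ℕ → κB → ℝ}
    {G₁ G₂ : ℕ → κB → Pt → ℝ} {D A : ℕ → ℝ} (hD : ∀ j, 0 ≤ D j) (hA : ∀ j, 0 ≤ A j) {δ : ℝ} (hδ : 0 < δ)
    (hwt0 : ∀ n : ℕ, 2 ≤ n → ∀ b ∈ Bset n, 0 ≤ wt n b) (hwt1 : ∀ n : ℕ, 2 ≤ n → ∑ b ∈ Bset n, wt n b = 1)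
    (h0₁ : ∀ n : ℕ, 2 ≤ n → ∀ b ∈ Bset n, ∀ v, |G₁ n b v - gFree v| ≤ D 0 / (n : ℝ) ^ 2)
    (h1₁ : ∀ n : ℕ, 2 ≤ n → ∀ b ∈ Bset n, ∀ v (ρ : Fin 4),
      |(G₁ n b (v + unitVec ρ) - gFree (v + unitVec ρ)) - (G₁ n b v - gFree v)| ≤ D 1 / (n : ℝ) ^ 3)
    (h2s₁ : ∀ n : ℕ, 2 ≤ n → ∀ b ∈ Bset n, ∀ r : ℕ, r + 1 ≤ n →
      ∑ v ∈ annulus 4 r (r + 1), |(G₁ n b (v + unitVec ν + unitVec μ) - gFree (v + unitVec ν + unitVec μ)) -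
          (G₁ n b (v + unitVec ν) - gFree (v + unitVec ν)) - (G₁ n b (v + unitVec μ) - gFree (v + unitVec μ)) +
          (G₁ n b v - gFree v)| ≤ D 2 / (n : ℝ))
    (d0₁ : ∀ n : ℕ, 2 ≤ n → ∀ b ∈ Bset n, ∀ v : Pt, v ≠ 0 → |G₁ n b v| ≤ A 0 * Real.exp (-(δ / n) * supNorm v) / (supNorm v : ℝ) ^ 2)
    (d1₁ : ∀ n : ℕ, 2 ≤ n → ∀ b ∈ Bset n, ∀ v : Pt, v ≠ 0 → ∀ ρ : Fin 4,
      |G₁ n b (v + unitVec ρ) - G₁ n b v| ≤ A 1 * Real.exp (-(δ / n) * supNorm v) / (supNorm v : ℝ) ^ 3)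
    (d2s₁ : ∀ n : ℕ, 2 ≤ n → ∀ b ∈ Bset n, ∀ r : ℕ, n ≤ r →
      ∑ v ∈ annulus 4 r (r + 1), |G₁ n b (v + unitVec ν + unitVec μ) - G₁ n b (v + unitVec ν) - G₁ n b (v + unitVec μ) + G₁ n b v| ≤
        A 2 * Real.exp (-(δ / n) * ((r : ℝ) + 1)) / ((r : ℝ) + 1))
    (h0₂ : ∀ n : ℕ, 2 ≤ n → ∀ b ∈ Bset n, ∀ v, |G₂ n b v - gFree v| ≤ D 0 / (n : ℝ) ^ 2)
    (h1₂ : ∀ n : ℕ, 2 ≤ n → ∀ b ∈ Bset n, ∀ v (ρ : Fin 4),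
      |(G₂ n b (v + unitVec ρ) - gFree (v + unitVec ρ)) - (G₂ n b v - gFree v)| ≤ D 1 / (n : ℝ) ^ 3)
    (h2s₂ : ∀ n : ℕ, 2 ≤ n → ∀ b ∈ Bset n, ∀ r : ℕ, r + 1 ≤ n →
      ∑ v ∈ annulus 4 r (r + 1), |(G₂ n b (v + unitVec ν + unitVec μ) - gFree (v + unitVec ν + unitVec μ)) -
          (G₂ n b (v + unitVec ν) - gFree (v + unitVec ν)) - (G₂ n b (v + unitVec μ) - gFree (v + unitVec μ)) +
          (G₂ n b v - gFree v)| ≤ D 2 / (n : ℝ))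
    (d0₂ : ∀ n : ℕ, 2 ≤ n → ∀ b ∈ Bset n, ∀ v : Pt, v ≠ 0 → |G₂ n b v| ≤ A 0 * Real.exp (-(δ / n) * supNorm v) / (supNorm v : ℝ) ^ 2)
    (d1₂ : ∀ n : ℕ, 2 ≤ n → ∀ b ∈ Bset n, ∀ v : Pt, v ≠ 0 → ∀ ρ : Fin 4,
      |G₂ n b (v + unitVec ρ) - G₂ n b v| ≤ A 1 * Real.exp (-(δ / n) * supNorm v) / (supNorm v : ℝ) ^ 3)
    (d2s₂ : ∀ n : ℕ, 2 ≤ n → ∀ b ∈ Bset n, ∀ r : ℕ, n ≤ r →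
      ∑ v ∈ annulus 4 r (r + 1), |G₂ n b (v + unitVec ν + unitVec μ) - G₂ n b (v + unitVec ν) - G₂ n b (v + unitVec μ) + G₂ n b v| ≤
        A 2 * Real.exp (-(δ / n) * ((r : ℝ) + 1)) / ((r : ℝ) + 1)) :
    ∃ U : ℝ, 0 ≤ U ∧ ∀ n : ℕ, 2 ≤ n →
      |∑ b ∈ Bset n, wt n b * fullSum (stKI μ ν N I (G₁ n b)) - ∑ b ∈ Bset n, wt n b * fullSum (stKI μ ν N I (G₂ n b))| ≤ U := by
  refine ⟨_, ?_, abs_avg_fullSum_stKI_sub_le_shell hμν N I hD hA hδ hwt0 hwt1 h0₁ h1₁ h2s₁ d0₁ d1₁ d2s₁ h0₂ h1₂ h2s₂ d0₂ d1₂ d2s₂⟩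
  have hDsh := shellWinConst_nonneg hμν N I hD
  have hEt := tailConst_nonneg hμν N I hA
  positivity

end Averaged

end

end Summit.QuantumFields.BalabanUV.Beta.D1BFx.GhostReleggingShellAvg
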